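import Literature.NumberTheory.CubicFields.FundCubicFieldCountSieve
import Literature.NumberTheory.CubicFields.LandauSieveTails
import HarnessLib

/-!
# BTT §5 for (3): the estimates `E₁, E₂, E₃` at `Q = X^{1/3−δ}` (lemmas for `FundCubicFieldCountLandau.lean`)

Topic `Literature/NumberTheory/CubicFields`; theorem-only companion of `FundCubicFieldCountLandau.lean`
(the bookkeeping of Bhargava–Taniguchi–Thorne 2023, §5, for the count (3) of cubic fields of
fundamental discriminant), on the tree's `nonFundCount s q X = N^±(X, Ψ_{q²})`
(`FundCubicFieldCountSieve.lean`) and the toolkit `LandauSieveTails.lean`: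

* `nonFundCount_eq_zero_of_lt_sq` — only `q² ≤ X` contribute to (20);
* `sum_Icc_abs_moebius_nonFundCount_le` — **`E₃`**: `Σ_{M ≤ q ≤ X} |μ(q) N(q;X)| ≤ C_U C₆ X Σ_{q>Q} q^{-(2−δ)}`
  from a uniformity bound `N ≤ C_U 6^{ω(q)} X/q²` (Prop. 4.5) and `6^{ω(q)} ≤ C₆ q^δ`;
* `sum_dyadic_landau_le` — **`E₂`**: the dyadic Landau bound summed over `[2^j, 2^{j+1})`, `j ≤ J`;
* `abs_sum_Ico_moebius_mul_sub_tsum_le` — **`E₁`**: completing `Σ_{q<M} μ(q) r(q)` to the full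
  (absolutely convergent) sum for residues `|r(q)| ≤ C q^{-a}`;
* `mul_rpow_neg_le_of_le`, `rpow_mul_rpow_neg_le_of_le`, `rpow_mul_two_pow_rpow_le`,
  `sqrt_le_rpow_two_thirds` — the exponent arithmetic of the choice `Q = X^{1/3−δ}`:
  `X Q^{−1+δ}, X^{5/6} Q^{−2/3+δ}, X^{3/5+δ} Q^{1/5} ≤ X^{2/3+2δ}`.

## References

* M. Bhargava, T. Taniguchi, F. Thorne, *Improved error estimates for the Davenport–Heilbronn
  theorems*, Math. Ann. 389 (2024) = arXiv:2107.12819, §5 (E₁, E₂, E₃; Q = X^{1/3−ε})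
  [BhargavaTaniguchiThorne2023].
-/

noncomputable section

open Finset ArithmeticFunction
open scoped ArithmeticFunction.Moebius

namespace Literature.NumberTheory.CubicFields

open BinaryCubic RingOfForm Literature.NumberTheory.QuadraticFields Classical

/-! ### Only `q² ≤ X` contribute -/

/-- `N^±(X, Ψ_{q²}) = 0` for squarefree `q` with `q² > X`: a sieved-out `D ≡ 0, 1 (4)` in the window has
`q² ∣ D`, `0 < |D| < X`. [folklore] -/
theorem nonFundCount_eq_zero_of_lt_sq {s : ℤ} (hs : s = 1 ∨ s = -1) {q X : ℕ} (hq : Squarefree q)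
    (h : X < q ^ 2) : nonFundCount s q X = 0 := by
  unfold nonFundCount
  refine Finset.sum_eq_zero fun D hD => ?_
  obtain ⟨hW, hT⟩ := Finset.mem_filter.mp hD
  have hD' := (mem_discWindow hs).mp hW
  by_cases h4 : D % 4 = 0 ∨ D % 4 = 1
  · exfalso
    have hD0 : D ≠ 0 := by rintro rfl; simp at hD'
    have hle : ((q : ℤ)) ^ 2 ≤ |D| :=
      Int.le_of_dvd (abs_pos.mpr hD0) ((dvd_abs _ _).mpr (sq_dvd_of_forall_not_isFundAt h4 hq hT))
    have habs : |D| < X := by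
      rcases hs with rfl | rfl
      · rw [abs_of_pos (by linarith [hD'.1])]; linarith [hD'.2]
      · rw [abs_of_neg (by linarith [hD'.1])]; linarith [hD'.2]
    have h' : ((q ^ 2 : ℕ) : ℤ) < X := by push_cast; exact hle.trans_lt habs
    exact absurd (by exact_mod_cast h' : q ^ 2 < X) (not_lt.mpr h.le)
  · exact shintaniCoeffReal_eq_zero_of_emod_four (by omega)

/-- Hence `μ(q) N^±(X, Ψ_{q²}) = 0` for every `q > X`. [folklore] -/
theorem moebius_mul_nonFundCount_eq_zero_of_lt {s : ℤ} (hs : s = 1 ∨ s = -1) {q X : ℕ} (h : X < q) :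
    ((μ q : ℤ) : ℝ) * nonFundCount s q X = 0 := by
  by_cases hq : Squarefree q
  · rw [nonFundCount_eq_zero_of_lt_sq hs hq (h.trans_le (Nat.le_self_pow two_ne_zero q)), mul_zero]
  · rw [ArithmeticFunction.moebius_eq_zero_of_not_squarefree hq]; simp

/-- `|μ(q) N^±(X, Ψ_{q²})| ≤ [q squarefree] · N^±(X, Ψ_{q²})`. [folklore] -/
theorem abs_moebius_mul_nonFundCount_le (s : ℤ) (q X : ℕ) :
    |((μ q : ℤ) : ℝ) * nonFundCount s q X| ≤ if Squarefree q then nonFundCount s q X else 0 := by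
  split_ifs with hq
  · rw [abs_mul, abs_of_nonneg (nonFundCount_nonneg s q X)]
    calc |((μ q : ℤ) : ℝ)| * nonFundCount s q X ≤ 1 * nonFundCount s q X := by
          refine mul_le_mul_of_nonneg_right ?_ (nonFundCount_nonneg s q X)
          exact_mod_cast ArithmeticFunction.abs_moebius_le_one
      _ = nonFundCount s q X := one_mul _
  · rw [ArithmeticFunction.moebius_eq_zero_of_not_squarefree hq]; simp

/-! ### `E₃`: the tail `q ≥ M` from the uniformity estimate -/

/-- **`E₃`**: under the uniformity bound `N^±(X, Ψ_{q²}) ≤ C_U 6^{ω(q)} X/q²` and `6^{ω(q)} ≤ C₆ q^δ`,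
`Σ_{M ≤ q ≤ X} |μ(q) N^±(X, Ψ_{q²})| ≤ C_U C₆ X · Σ_{Q < q ≤ X} q^{-(2-δ)}` for `Q < M`. [cite: BhargavaTaniguchiThorne2023, §5 (E₃ ≪ X Σ_{q>Q} 6^{ω(q)} q^{-2})] -/
theorem sum_Icc_abs_moebius_nonFundCount_le {s : ℤ} {C_U C₆ δ : ℝ} (hCU : 0 ≤ C_U)
    (hU : ∀ q : ℕ, Squarefree q → ∀ X : ℕ, nonFundCount s q X ≤ C_U * 6 ^ q.primeFactors.card * X / (q : ℝ) ^ 2)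
    (h6 : ∀ q : ℕ, q ≠ 0 → (6 : ℝ) ^ q.primeFactors.card ≤ C₆ * (q : ℝ) ^ δ) {Q M : ℕ} (hQM : Q < M) (X : ℕ) :
    ∑ q ∈ Finset.Icc M X, |((μ q : ℤ) : ℝ) * nonFundCount s q X| ≤
      C_U * C₆ * X * ∑ q ∈ Finset.Ioc Q X, (q : ℝ) ^ (-(2 - δ)) := by
  have hC6 : 0 ≤ C₆ := by
    have := h6 1 one_ne_zero
    simp at this
    linarith
  calc ∑ q ∈ Finset.Icc M X, |((μ q : ℤ) : ℝ) * nonFundCount s q X|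
      ≤ ∑ q ∈ Finset.Icc M X, C_U * C₆ * X * (q : ℝ) ^ (-(2 - δ)) := by
        refine Finset.sum_le_sum fun q hq => (abs_moebius_mul_nonFundCount_le s q X).trans ?_
        have hq1 : 1 ≤ q := le_trans (Nat.succ_le_of_lt (Nat.zero_lt_of_lt hQM)) (Finset.mem_Icc.mp hq).1
        have hq0 : (0 : ℝ) < q := by exact_mod_cast hq1
        split_ifs with hsq
        · calc nonFundCount s q X ≤ C_U * 6 ^ q.primeFactors.card * X / (q : ℝ) ^ 2 := hU q hsq X
            _ ≤ C_U * (C₆ * (q : ℝ) ^ δ) * X / (q : ℝ) ^ 2 := by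
                gcongr
                exact h6 q (by omega)
            _ = C_U * C₆ * X * (q : ℝ) ^ (-(2 - δ)) := by
                rw [show -(2 - δ) = δ - 2 by ring, Real.rpow_sub hq0, Real.rpow_two]
                ring
        · positivity
    _ = C_U * C₆ * X * ∑ q ∈ Finset.Icc M X, (q : ℝ) ^ (-(2 - δ)) := by rw [Finset.mul_sum]
    _ ≤ C_U * C₆ * X * ∑ q ∈ Finset.Ioc Q X, (q : ℝ) ^ (-(2 - δ)) := by
        refine mul_le_mul_of_nonneg_left (Finset.sum_le_sum_of_subset_of_nonneg ?_ fun q _ _ => by positivity)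
          (by positivity)
        intro q hq
        rw [Finset.mem_Icc] at hq
        rw [Finset.mem_Ioc]
        omega

/-! ### `E₂`: the dyadic blocks `q < 2^{J+1}` -/

/-- **`E₂`**: summing the dyadic Landau bound over the blocks `[2^j, 2^{j+1})`, `j ≤ J`, with
`2^J ≤ X^{1/3−δ}`: `Σ_{q < 2^{J+1} sqfree} |N − r₁X − r₂X^{5/6}| ≤ 16 C X^{3/5+δ} (2^J)^{1/5}`.
[cite: BhargavaTaniguchiThorne2023, §5 (E₂ = X^{3/5} Σ_{Q₁} (Σ δ₁)^{3/5} (Σ δ̂₁)^{2/5} ≪ X^{3/5} Q^{1/5+ε})] -/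
theorem sum_dyadic_landau_le {s : ℤ} {r₁ r₂ : ℕ → ℝ} {C δ : ℝ} (hC : 0 ≤ C)
    (hLan : ∀ X : ℕ, 1 ≤ X → ∀ Q₁ : ℕ, 1 ≤ Q₁ → (Q₁ : ℝ) ≤ (X : ℝ) ^ ((1 : ℝ) / 3 - δ) →
      ∑ q ∈ (Finset.Ico Q₁ (2 * Q₁)).filter Squarefree,
          |nonFundCount s q X - r₁ q * X - r₂ q * (X : ℝ) ^ ((5 : ℝ) / 6)|
        ≤ C * (X : ℝ) ^ ((3 : ℝ) / 5 + δ) * (Q₁ : ℝ) ^ ((1 : ℝ) / 5))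
    {X : ℕ} (hX : 1 ≤ X) {J : ℕ} (hJ : ((2 : ℝ) ^ J) ≤ (X : ℝ) ^ ((1 : ℝ) / 3 - δ)) :
    ∑ q ∈ (Finset.Ico 1 (2 ^ (J + 1))).filter Squarefree,
        |nonFundCount s q X - r₁ q * X - r₂ q * (X : ℝ) ^ ((5 : ℝ) / 6)|
      ≤ 16 * C * (X : ℝ) ^ ((3 : ℝ) / 5 + δ) * ((2 : ℝ) ^ J) ^ ((1 : ℝ) / 5) := by
  rw [Finset.sum_filter, sum_Ico_one_two_pow_eq_sum_range]
  calc ∑ j ∈ Finset.range (J + 1), ∑ q ∈ Finset.Ico (2 ^ j) (2 ^ (j + 1)),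
        (if Squarefree q then |nonFundCount s q X - r₁ q * X - r₂ q * (X : ℝ) ^ ((5 : ℝ) / 6)| else 0)
      ≤ ∑ j ∈ Finset.range (J + 1), C * (X : ℝ) ^ ((3 : ℝ) / 5 + δ) * ((2 : ℝ) ^ j) ^ ((1 : ℝ) / 5) := by
        refine Finset.sum_le_sum fun j hj => ?_
        rw [← Finset.sum_filter, pow_succ, mul_comm (2 ^ j) 2]
        have hjJ : j ≤ J := Nat.lt_succ_iff.mp (Finset.mem_range.mp hj)
        have h2j : ((2 ^ j : ℕ) : ℝ) ≤ (X : ℝ) ^ ((1 : ℝ) / 3 - δ) := by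
          push_cast
          exact le_trans (pow_le_pow_right₀ (by norm_num) hjJ) hJ
        have := hLan X hX (2 ^ j) Nat.one_le_two_pow h2j
        push_cast at this
        exact this
    _ = C * (X : ℝ) ^ ((3 : ℝ) / 5 + δ) * ∑ j ∈ Finset.range (J + 1), ((2 : ℝ) ^ j) ^ ((1 : ℝ) / 5) := by
        rw [Finset.mul_sum]
    _ ≤ C * (X : ℝ) ^ ((3 : ℝ) / 5 + δ) * (16 * ((2 : ℝ) ^ J) ^ ((1 : ℝ) / 5)) :=
        mul_le_mul_of_nonneg_left (sum_range_two_pow_rpow_fifth_le J) (by positivity)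
    _ = 16 * C * (X : ℝ) ^ ((3 : ℝ) / 5 + δ) * ((2 : ℝ) ^ J) ^ ((1 : ℝ) / 5) := by ring

/-! ### `E₁`: completing the sieved residue sums -/

/-- **`E₁`**: for `|r(q)| ≤ C q^{-a+…}`-type residues, `|X^σ Σ_{q<M} μ(q) r(q) − X^σ Σ_q μ(q) r(q)| ≤
X^σ · C (a/(a−1)) M^{1−a}` (`abs_tsum_sub_sum_range_le` for `h = μ·r`). [cite: BhargavaTaniguchiThorne2023, §5 (E₁ = Σ_σ X^σ Σ_{q>Q} |Res_{s=σ} ξ^±(s, Ψ_{q²})|)] -/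
theorem abs_sum_Ico_moebius_mul_sub_tsum_le {r : ℕ → ℝ} {C a : ℝ} (ha : 1 < a) (hC : 0 ≤ C)
    (hr : ∀ q : ℕ, Squarefree q → |r q| ≤ C * (q : ℝ) ^ (-a)) {M : ℕ} (hM : 1 ≤ M) :
    |∑ q ∈ Finset.Ico 1 M, ((μ q : ℤ) : ℝ) * r q - ∑' q, ((μ q : ℤ) : ℝ) * r q| ≤ C * (a / (a - 1)) * (M : ℝ) ^ (1 - a) := by
  have h0 : ((μ 0 : ℤ) : ℝ) * r 0 = 0 := by simp
  have hb : ∀ q : ℕ, 1 ≤ q → |((μ q : ℤ) : ℝ) * r q| ≤ C * (q : ℝ) ^ (-a) := by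
    intro q _
    by_cases hq : Squarefree q
    · rw [abs_mul]
      calc |((μ q : ℤ) : ℝ)| * |r q| ≤ 1 * |r q| :=
            mul_le_mul_of_nonneg_right (by exact_mod_cast ArithmeticFunction.abs_moebius_le_one) (abs_nonneg _)
        _ ≤ C * (q : ℝ) ^ (-a) := by rw [one_mul]; exact hr q hq
    · rw [ArithmeticFunction.moebius_eq_zero_of_not_squarefree hq]
      simp only [Int.cast_zero, zero_mul, abs_zero]
      positivity
  have hIco : ∑ q ∈ Finset.Ico 1 M, ((μ q : ℤ) : ℝ) * r q = ∑ q ∈ Finset.range M, ((μ q : ℤ) : ℝ) * r q := by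
    rw [Finset.range_eq_Ico, Finset.sum_eq_sum_Ico_succ_bot hM, h0, zero_add]
  rw [hIco, abs_sub_comm]
  exact abs_tsum_sub_sum_range_le ha hC h0 hb hM

/-! ### Exponent bookkeeping at `Q = X^{1/3−δ}` -/

/-- For `X ≥ 1`, `0 ≤ δ ≤ 1/30`, `Y = X^{1/3−δ}` and `M ≥ Y`: `X · M^{−(1−δ)} ≤ X^{2/3+2δ}`. [folklore] -/
theorem mul_rpow_neg_le_of_le {X M δ : ℝ} (hX : 1 ≤ X) (hδ0 : 0 ≤ δ) (hδ : δ ≤ 1 / 30)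
    (hM : X ^ ((1 : ℝ) / 3 - δ) ≤ M) : X * M ^ (1 - (2 - δ)) ≤ X ^ ((2 : ℝ) / 3 + 2 * δ) := by
  have hX0 : 0 < X := one_pos.trans_le hX
  have hY0 : 0 < X ^ ((1 : ℝ) / 3 - δ) := Real.rpow_pos_of_pos hX0 _
  calc X * M ^ (1 - (2 - δ)) ≤ X * (X ^ ((1 : ℝ) / 3 - δ)) ^ (1 - (2 - δ)) := by
        refine mul_le_mul_of_nonneg_left (Real.rpow_le_rpow_of_nonpos hY0 hM (by linarith)) hX0.le
    _ = X ^ (1 + ((1 : ℝ) / 3 - δ) * (1 - (2 - δ))) := by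
        rw [← Real.rpow_mul hX0.le, Real.rpow_add hX0, Real.rpow_one]
    _ ≤ X ^ ((2 : ℝ) / 3 + 2 * δ) := Real.rpow_le_rpow_of_exponent_le hX (by nlinarith)

/-- For `X ≥ 1`, `0 ≤ δ ≤ 1/30`, `M ≥ X^{1/3−δ}`: `X^{5/6} · M^{−(2/3−δ)} ≤ X^{2/3+2δ}`. [folklore] -/
theorem rpow_mul_rpow_neg_le_of_le {X M δ : ℝ} (hX : 1 ≤ X) (hδ0 : 0 ≤ δ) (hδ : δ ≤ 1 / 30)
    (hM : X ^ ((1 : ℝ) / 3 - δ) ≤ M) :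
    X ^ ((5 : ℝ) / 6) * M ^ (1 - (5 / 3 - δ)) ≤ X ^ ((2 : ℝ) / 3 + 2 * δ) := by
  have hX0 : 0 < X := one_pos.trans_le hX
  have hY0 : 0 < X ^ ((1 : ℝ) / 3 - δ) := Real.rpow_pos_of_pos hX0 _
  calc X ^ ((5 : ℝ) / 6) * M ^ (1 - (5 / 3 - δ)) ≤ X ^ ((5 : ℝ) / 6) * (X ^ ((1 : ℝ) / 3 - δ)) ^ (1 - (5 / 3 - δ)) := by
        refine mul_le_mul_of_nonneg_left (Real.rpow_le_rpow_of_nonpos hY0 hM (by linarith)) (by positivity)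
    _ = X ^ ((5 : ℝ) / 6 + ((1 : ℝ) / 3 - δ) * (1 - (5 / 3 - δ))) := by
        rw [← Real.rpow_mul hX0.le, Real.rpow_add hX0]
    _ ≤ X ^ ((2 : ℝ) / 3 + 2 * δ) := Real.rpow_le_rpow_of_exponent_le hX (by nlinarith)

/-- For `X ≥ 1`, `0 ≤ δ`, `2^J ≤ X^{1/3−δ}`: `X^{3/5+δ} (2^J)^{1/5} ≤ X^{2/3+2δ}`. [folklore] -/
theorem rpow_mul_two_pow_rpow_le {X δ : ℝ} (hX : 1 ≤ X) (hδ0 : 0 ≤ δ) {J : ℕ} (hJ : ((2 : ℝ) ^ J) ≤ X ^ ((1 : ℝ) / 3 - δ)) :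
    X ^ ((3 : ℝ) / 5 + δ) * ((2 : ℝ) ^ J) ^ ((1 : ℝ) / 5) ≤ X ^ ((2 : ℝ) / 3 + 2 * δ) := by
  have hX0 : 0 < X := one_pos.trans_le hX
  calc X ^ ((3 : ℝ) / 5 + δ) * ((2 : ℝ) ^ J) ^ ((1 : ℝ) / 5)
      ≤ X ^ ((3 : ℝ) / 5 + δ) * (X ^ ((1 : ℝ) / 3 - δ)) ^ ((1 : ℝ) / 5) := by
        refine mul_le_mul_of_nonneg_left (Real.rpow_le_rpow (by positivity) hJ (by norm_num)) (by positivity)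
    _ = X ^ ((3 : ℝ) / 5 + δ + ((1 : ℝ) / 3 - δ) * ((1 : ℝ) / 5)) := by
        rw [← Real.rpow_mul hX0.le, ← Real.rpow_add hX0]
    _ ≤ X ^ ((2 : ℝ) / 3 + 2 * δ) := Real.rpow_le_rpow_of_exponent_le hX (by nlinarith)

/-! ### Exponent comparison for the final assembly -/

/-- `√X ≤ X^{2/3+ε}` and `1 ≤ X^{2/3+ε}` for `X ≥ 1`, `ε ≥ 0`. [folklore] -/
theorem sqrt_le_rpow_two_thirds {X ε : ℝ} (hX : 1 ≤ X) (hε : 0 ≤ ε) :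
    Real.sqrt X ≤ X ^ ((2 : ℝ) / 3 + ε) ∧ 1 ≤ X ^ ((2 : ℝ) / 3 + ε) := by
  constructor
  · rw [Real.sqrt_eq_rpow]
    exact Real.rpow_le_rpow_of_exponent_le hX (by linarith)
  · exact Real.one_le_rpow hX (by linarith)

end Literature.NumberTheory.CubicFields

end
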